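import Summits.Ventures.HodgeRepro2.T5NormOneCharacters

/-!
# T5NormOneUniformiser — E¹ through a uniformiser: unramified and ramified places (seat p3)

Kernel witnesses behind TWO lines already on the record: route/T5-route-3.md v0.31 §F.1 (ii)
«at v with E_v/F⁺_v UNRAMIFIED and χ_v unramified: every y ∈ E¹_v is u/ū with u ∈ O_{E_v}^×
(Hilbert 90 + x = ϖ_F^k u, ϖ_F ∈ F⁺_v) ⟹ ν_{χ_v}(y) = χ_v(u) = 1 ⟹ c_v = 1» and (iii) «at v
non-split with E_v/F⁺_v RAMIFIED: [E¹_v : {u/ū : u ∈ O_{E_v}^×}] = 2 (the class of ϖ_E/ϖ̄_E) and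
ν_{χ_v}(ϖ_E/ϖ̄_E) = χ_v(ϖ_E) = ±1 can be −1 for an UNRAMIFIED χ_v (χ_v|_{F^×} = 1 only forces
χ_v(ϖ_E)² = χ_v(ϖ_F·unit) = 1)».

ABSTRACT SETTING (no local field, no valuation): `L` a field with a ring involution `c`
(E_v with its conjugation), `U ≤ Lˣ` a subgroup (the units O_{E_v}^×), `ϖ ∈ Lˣ` a «uniformiser»
with the decomposition `Lˣ = ϖ^ℤ · U` (hypothesis `hdec`), `jHom c : a ↦ a / c a`, `normOne`
= E¹ (`ShimuraData.B3Characters`), Hilbert 90 in subgroup form and the factorisation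
φ = ν ∘ jHomNormOne of a character trivial on the fixed units from `T5NormOneCharacters`.

* UNRAMIFIED (`c ϖ = ϖ`): `exists_jHom_units_of_fixed` (every norm-one element is u/c u with
  u ∈ U) and `factor_eq_one_of_unramified` (a character trivial on U and on the fixed units has
  trivial factor ν — «c_v = 1»);
* RAMIFIED / general (`ϖ² = f·w`, f fixed, w ∈ U): `exists_jHom_or_jHom_mul` (every norm-one
  element lies in j(U) or in j(ϖ)·j(U): index ≤ 2), `map_uniformiser_sq_eq_one` (φ(ϖ)² = 1),
  `factor_mem_of_unramified` (ν(y) ∈ {1, φ(ϖ)}), and `jHom_uniformiser_notMem` (fixed elements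
  have even ϖ-valuation ⟹ ϖ/c ϖ ∉ j(U): the index is exactly 2).

What stays prose: that O_{E_v}^×, ϖ_E, ϖ_F are these objects (p4's DVR / completion files) and
the topology.  README §8(d): this file uses an L-value-free non-vanishing device: NO.
-/

namespace Summit.Ventures.HodgeRepro2.T5NormOneUniformiser

open ShimuraData.B3Characters T5NormOneCharacters

variable {L : Type*} [Field L] (c : L ≃+* L)

section jHom_lemmas

/-- `jHom` of a `c`-fixed unit is `1`. -/
theorem jHom_eq_one_of_fixed {a : Lˣ} (ha : unitsConj c a = a) : jHom (unitsConj c) a = 1 :=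
  (mem_ker_jHom_iff _ _).mpr ha

/-- `jHom a = jHom b ⟺ a · c b = b · c a` (cross-multiplication). -/
theorem jHom_eq_iff (a b : Lˣ) :
    jHom (unitsConj c) a = jHom (unitsConj c) b ↔ a * unitsConj c b = b * unitsConj c a := by
  rw [jHom_apply, jHom_apply, mul_inv_eq_iff_eq_mul, mul_right_comm, eq_mul_inv_iff_mul_eq]

/-- `jHom (ϖ ^ k * u) = (jHom ϖ) ^ k * jHom u`. -/
theorem jHom_zpow_mul (ϖ u : Lˣ) (k : ℤ) :
    jHom (unitsConj c) (ϖ ^ k * u) = (jHom (unitsConj c) ϖ) ^ k * jHom (unitsConj c) u := by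
  rw [map_mul, map_zpow]

end jHom_lemmas

section unramified

variable (ϖ : Lˣ) (U : Subgroup Lˣ)

/-- UNRAMIFIED: if the uniformiser is `c`-fixed and `Lˣ = ϖ^ℤ · U`, every norm-one unit is
`u / c u` with `u ∈ U` («every y ∈ E¹_v is u/ū with u ∈ O_{E_v}^×»). -/
theorem exists_jHom_units_of_fixed (hc : ∀ x, c (c x) = x) (hne : ∃ a, c a ≠ a)
    (hϖ : unitsConj c ϖ = ϖ)
    (hdec : ∀ a : Lˣ, ∃ k : ℤ, ∃ u ∈ U, a = ϖ ^ k * u) {y : Lˣ}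
    (hy : y ∈ normOne (unitsConj c)) : ∃ u ∈ U, y = jHom (unitsConj c) u := by
  rw [← range_jHom_eq_normOne c hc hne] at hy
  obtain ⟨a, rfl⟩ := hy
  obtain ⟨k, u, hu, rfl⟩ := hdec a
  refine ⟨u, hu, ?_⟩
  rw [jHom_zpow_mul, jHom_eq_one_of_fixed c hϖ, one_zpow, one_mul]

variable {M : Type*} [Group M]

/-- The factor `ν` of a character `φ` (file 31: φ a = ν (a / c a)) is determined on `E¹` by the
values of `φ` on `U` when every norm-one unit is `u / c u`, `u ∈ U`. -/
theorem factor_apply_eq_of_jHom (hc : ∀ x, c (c x) = x) (φ : Lˣ →* M) (ν : normOne (unitsConj c) →* M)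
    (hν : ∀ a, φ a = ν (jHomNormOne c hc a)) (y : normOne (unitsConj c)) (u : Lˣ)
    (hu : (y : Lˣ) = jHom (unitsConj c) u) : ν y = φ u := by
  have h : jHomNormOne c hc u = y := by
    apply Subtype.ext
    apply Units.ext
    rw [coe_jHomNormOne, hu, coe_jHom]
  rw [← h, hν]

/-- UNRAMIFIED CHARACTER: if `φ` is trivial on `U` and on the fixed units, its factor `ν` is
trivial on `E¹` («ν_{χ_v}(y) = χ_v(u) = 1 ⟹ c_v = 1»). -/
theorem factor_eq_one_of_unramified (hc : ∀ x, c (c x) = x) (hne : ∃ a, c a ≠ a)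
    (hϖ : unitsConj c ϖ = ϖ)
    (hdec : ∀ a : Lˣ, ∃ k : ℤ, ∃ u ∈ U, a = ϖ ^ k * u) (φ : Lˣ →* M)
    (hU : ∀ u ∈ U, φ u = 1) (ν : normOne (unitsConj c) →* M)
    (hν : ∀ a, φ a = ν (jHomNormOne c hc a)) (y : normOne (unitsConj c)) : ν y = 1 := by
  obtain ⟨u, hu, hyu⟩ := exists_jHom_units_of_fixed c ϖ U hc hne hϖ hdec y.2
  rw [factor_apply_eq_of_jHom c hc φ ν hν y u hyu]
  exact hU u hu

end unramified

section ramified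

variable (ϖ : Lˣ) (U : Subgroup Lˣ)

/-- If `ϖ ^ 2 = f * w` with `f` fixed and `w ∈ U`, then `(jHom ϖ) ^ 2 = jHom w`. -/
theorem jHom_sq_eq (f w : Lˣ) (hf : unitsConj c f = f) (hsq : ϖ ^ 2 = f * w) :
    (jHom (unitsConj c) ϖ) ^ 2 = jHom (unitsConj c) w := by
  rw [← map_pow, hsq, map_mul, jHom_eq_one_of_fixed c hf, one_mul]

/-- `(jHom ϖ) ^ k` lies in `j(U)` or in `jHom ϖ · j(U)` according to the parity of `k`. -/
theorem jHom_zpow_mem_or (f w : Lˣ) (hf : unitsConj c f = f) (hsq : ϖ ^ 2 = f * w) (hw : w ∈ U)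
    (k : ℤ) : ∃ v ∈ U, (jHom (unitsConj c) ϖ) ^ k = jHom (unitsConj c) v ∨
      (jHom (unitsConj c) ϖ) ^ k = jHom (unitsConj c) ϖ * jHom (unitsConj c) v := by
  have hsqk : (jHom (unitsConj c) ϖ) ^ (2 * (k / 2)) = jHom (unitsConj c) (w ^ (k / 2)) := by
    rw [zpow_mul, map_zpow, ← jHom_sq_eq c ϖ f w hf hsq]
    norm_cast
  have hsplit : (jHom (unitsConj c) ϖ) ^ k =
      (jHom (unitsConj c) ϖ) ^ (2 * (k / 2)) * (jHom (unitsConj c) ϖ) ^ (k % 2) := by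
    rw [← zpow_add]
    congr 1
    omega
  refine ⟨w ^ (k / 2), U.zpow_mem hw _, ?_⟩
  rcases Int.emod_two_eq_zero_or_one k with h | h
  · left
    rw [hsplit, h, zpow_zero, mul_one, hsqk]
  · right
    rw [hsplit, h, zpow_one, hsqk, mul_comm]

/-- INDEX ≤ 2: with `Lˣ = ϖ^ℤ · U` and `ϖ ^ 2 = f · w` (`f` fixed, `w ∈ U`), every norm-one
unit lies in `j(U)` or in `jHom ϖ · j(U)` («[E¹_v : {u/ū}] ≤ 2, the class of ϖ_E/ϖ̄_E»). -/
theorem exists_jHom_or_jHom_mul (hc : ∀ x, c (c x) = x) (hne : ∃ a, c a ≠ a)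
    (hdec : ∀ a : Lˣ, ∃ k : ℤ, ∃ u ∈ U, a = ϖ ^ k * u)
    (f w : Lˣ) (hf : unitsConj c f = f) (hsq : ϖ ^ 2 = f * w) (hw : w ∈ U) {y : Lˣ}
    (hy : y ∈ normOne (unitsConj c)) :
    ∃ u ∈ U, y = jHom (unitsConj c) u ∨ y = jHom (unitsConj c) ϖ * jHom (unitsConj c) u := by
  rw [← range_jHom_eq_normOne c hc hne] at hy
  obtain ⟨a, rfl⟩ := hy
  obtain ⟨k, u, hu, rfl⟩ := hdec a
  obtain ⟨v, hv, hv'⟩ := jHom_zpow_mem_or c ϖ U f w hf hsq hw k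
  refine ⟨v * u, U.mul_mem hv hu, ?_⟩
  rw [jHom_zpow_mul, map_mul]
  rcases hv' with h | h
  · left
    rw [h]
  · right
    rw [h, mul_assoc]

variable {M : Type*} [Group M]

/-- `φ(ϖ) ^ 2 = 1` for a character trivial on `U` and on the fixed units when `ϖ ^ 2 = f · w`
(«χ_v(ϖ_E)² = χ_v(ϖ_F·unit) = 1»). -/
theorem map_uniformiser_sq_eq_one (φ : Lˣ →* M) (hφ : ∀ a : Lˣ, c (a : L) = a → φ a = 1)
    (hU : ∀ u ∈ U, φ u = 1) (f w : Lˣ) (hf : unitsConj c f = f) (hsq : ϖ ^ 2 = f * w)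
    (hw : w ∈ U) : (φ ϖ) ^ 2 = 1 := by
  rw [← map_pow, hsq, map_mul, hU w hw, mul_one]
  exact hφ f (by rw [← coe_unitsConj, hf])

/-- The factor `ν` of an unramified character takes only the values `1` and `φ(ϖ)` on `E¹`
(«ν_{χ_v}(ϖ_E/ϖ̄_E) = χ_v(ϖ_E) = ±1»). -/
theorem factor_mem_of_unramified (hc : ∀ x, c (c x) = x) (hne : ∃ a, c a ≠ a)
    (hdec : ∀ a : Lˣ, ∃ k : ℤ, ∃ u ∈ U, a = ϖ ^ k * u)
    (f w : Lˣ) (hf : unitsConj c f = f) (hsq : ϖ ^ 2 = f * w) (hw : w ∈ U) (φ : Lˣ →* M)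
    (hU : ∀ u ∈ U, φ u = 1) (ν : normOne (unitsConj c) →* M)
    (hν : ∀ a, φ a = ν (jHomNormOne c hc a)) (y : normOne (unitsConj c)) :
    ν y = 1 ∨ ν y = φ ϖ := by
  obtain ⟨u, hu, h | h⟩ := exists_jHom_or_jHom_mul c ϖ U hc hne hdec f w hf hsq hw y.2
  · left
    rw [factor_apply_eq_of_jHom c hc φ ν hν y u h]
    exact hU u hu
  · right
    rw [← map_mul] at h
    rw [factor_apply_eq_of_jHom c hc φ ν hν y (ϖ * u) h, map_mul, hU u hu, mul_one]

/-- INDEX EXACTLY 2: if the `c`-fixed units have even `ϖ`-valuation (`f = ϖ^{2m} · w`) and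
`ϖ ^ k ∈ U` forces `k = 0`, then `ϖ / c ϖ` is NOT of the form `u / c u` with `u ∈ U`. -/
theorem jHom_uniformiser_notMem
    (hfix : ∀ f : Lˣ, unitsConj c f = f → ∃ m : ℤ, ∃ w ∈ U, f = ϖ ^ (2 * m) * w)
    (hϖU : ∀ k : ℤ, ϖ ^ k ∈ U → k = 0) (u : Lˣ) (hu : u ∈ U) :
    jHom (unitsConj c) ϖ ≠ jHom (unitsConj c) u := by
  intro h
  rw [jHom_eq_iff] at h
  have hfixed : unitsConj c (ϖ * u⁻¹) = ϖ * u⁻¹ := by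
    rw [map_mul, map_inv, mul_inv_eq_iff_eq_mul, mul_right_comm, h, mul_inv_cancel_comm]
  obtain ⟨m, w, hw, hmw⟩ := hfix _ hfixed
  have h3 : ϖ = ϖ ^ (2 * m) * w * u := mul_inv_eq_iff_eq_mul.mp hmw
  have hpow : ϖ ^ (1 - 2 * m) ∈ U := by
    have : ϖ ^ (1 - 2 * m) = w * u := by
      rw [zpow_sub, zpow_one]
      nth_rw 1 [h3]
      rw [mul_assoc (ϖ ^ (2 * m)) w u, mul_inv_cancel_comm]
    rw [this]
    exact U.mul_mem hw hu
  have := hϖU _ hpow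
  omega

end ramified

end Summit.Ventures.HodgeRepro2.T5NormOneUniformiser
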